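import Literature.MathematicalPhysics.QuantumFieldTheory.Balaban1983to89.B9Eq316TowerFlatIsOneStep
import Literature.MathematicalPhysics.QuantumFieldTheory.Balaban1983to89.B9Eq315QFlatNorm

/-!
# `Balaban1983to89.B9Eq315QTowerFlatNorm` — T. Bałaban, *Propagators for lattice gauge theories in a background field*, Commun. Math. Phys. **99**
# (1985) 389–434 [Balaban1985BackgroundPropagators] (3.15)–(3.16) p. 393 with [Balaban1984PropagatorsI] (1.18) p. 20 and [Balaban1985Averaging] (125)
# p. 36: **THE FLAT COMPOSITE VECTOR AVERAGING `Q_k(1)` OF THE NE9 TOWER IS BOUNDED ON THE WEIGHTED `L²` SPACES WITH A VOLUME-FREE CONSTANT —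
# `‖Q_k(1)f‖_{L²(c₁)} ≤ M_φ′·M_φ·√(c₁ ∕ (c₀·L^{kd}))·‖f‖_{L²(c₀)}`, i.e. `M_φ′M_φ·(ηL^k)⁻¹` along print's weights `c₁(ηL^k)² = c₀L^{kd}`**

statement-level skeleton of published theorems with citation tags; proofs where landed; nothing here is a claim about the Yang–Mills mass gap

PDF held: `paper:balaban1985-cmp99-background-propagators` (journal page = PDF page + 388) p. 393 read by this seat (2026-08-22, text layer p0005):
*«They are compositions of j one-step averaging operators Q_j(U) = Q(Ū^{j−1})…Q(U) (3.15)»*, *«⟨A, Q*aQA⟩ = Σ_{j=0}^{k} a Σ_{b∈Λ_j} (L^jη)^{d−2}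
|(Q_j(U)A)(b)|² (3.16)»*; [Balaban1985Averaging] p. 39 (p0023): *«A composition of k operators Q is the operator Q_k.»*; [B5] (1.18) p. 20 through the
tree's `B7Prop4Flat` ∕ `B9Eq316TowerFlatIsOneStep` docstrings: *«(Q_kA)_b = Σ_{x∈B^k(b₋)} η^{d+1} A([x, x(b)])»* — at the flat background the `k`-fold
composite IS one block mean over blocks of side `L^k`.

WHY THIS FILE (cell context).  The NE9 owner's tower files display the flat letter `M_Q` — `‖Q_k(1)x‖ ≤ M_Q‖x‖` — as a free binder
(`B9Thm311SmallFieldCoercivityTowerScaled.exists_strong_coercive_of_scaled_letters_tower`'s `hQ₁`; `B9Eq3126H1BoundTower` §3's `M_{Q1}`), and the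
one-step chain made it explicit and VOLUME-FREE (`B9Eq315QFlatNorm.norm_QtorusW_one_le`, ne9-leaf-03: each coarse value is a mean over `L^{d+1}` fine
bonds, each fine bond is read `L` times).  The owner's identification `B9Eq316TowerFlatIsOneStep.QkW_one_eq_oneStep` (gen 84: `Q_k(1) = Q^{(L^k)}(1) ∘ Φ`,
`Φ` the bond-`L²` isometry along `towerP L m k = fineP (L^k) m`) ports that one-step bound to the tower VERBATIM at block size `L^k`: NO `√|𝔅(T)|`, no
number-of-levels factor beyond print's own `(ηL^k)⁻¹`.  (The sup→`L²` road would give `√(c₁|𝔅(T_m)|∕c₀) = √|𝔅(T_{L^k m})|∕(ηL^k)` instead — the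
fine volume; cf. this lineage's journal note on `B9Eq315QTowerLipschitzProfile` (M3).)

WHAT IS PROVED (sorry-free; proof lane — no `def`, no `Prop` placeholder, no inequality of the papers asserted).
* §1 `flat_oneStep_data_pow` — the one-step flat background at block size `L^k` inhabits E162's displayed data (unit-bounded, block loops exactly `1`).
* §2 **`norm_QkW_one_le`** — `‖Q_{n+1}(1)f‖ ≤ M_φ′·M_φ·√(c₁∕(c₀·L^{(n+1)d}))·‖f‖` for EVERY admissible set of displayed per-level letters `(α, hα1, hU1, hreg)`
  (the value of `QkW … 1 …` does not depend on them); **`opNorm_QkW_one_le`** — the same number bounds `‖LinearMap.toContinuousLinearMap (Q_{n+1}(1))‖`.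
* §3 **`norm_QkW_one_le_canonical`** — along print's weights `c₁·(ηL^{n+1})² = c₀·L^{(n+1)d}` ((3.16): `c₀ = η^d`, `c₁ = (L^kη)^{d−2}`), `0 < ηL^{n+1}`:
  `‖Q_{n+1}(1)f‖ ≤ M_φ′·M_φ·(ηL^{n+1})⁻¹·‖f‖` — `= M_φ′M_φ` on print's unit lattice `ηL^k = 1`; free of `m`, `L`, `k` otherwise.
MODEL ∕ DECLARED READINGS.  (M1) those of `B9Eq326OperatorTower` ∕ `B9Eq316TowerFlatIsOneStep` (periodic readings, weights `c₀`∕`c₁`, fibre letters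
`‖φw‖ ≤ M_φ‖w‖`, `‖φ⁻¹X‖ ≤ M_φ′‖X‖`); (M2) FLAT background only — `Q_k(U) − Q_k(1)` is the tower Lipschitz letter `δ_{Q,k}` of `B9Eq315QTowerLipschitz(Profile)`,
not touched here.
HONEST SCOPE.  [folklore] a 3-line transport of ne9-leaf-03's one-step count along the owner's identification; one displayed binder (`M_Q` of the tower)
made explicit and volume-free; nothing of [B9] Thm 3.11 ∕ (3.35)–(3.37); NOT summit progress (cell pub-balaban: NE9 NOT PRINTED ∕ NOT PROVED, «NE9 ⇐ the
named binders»; row WALLED ON A MODEL; spine PROVED 0∕9; rung (B)+1 finite T⁴ — NOT infinite volume, NOT mass gap, NOT Clay; HONEST DEPENDENCY: continuum YM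
on T⁴ ⇐ BetaPertH ∧ nine spine estimates (0/9 proved); BetaPertH ⇐ (D1) ∧ (D4) ∧ CAP+tail; G-an2-4 gates asym, D1 and NE2/3/4).  Filed by the NE9
crux-team leaf seat `b2b-balaban-t4-ne9-formalise-leaf-02` (gen 64); NEW file importing `B9Eq316TowerFlatIsOneStep` and `B9Eq315QFlatNorm`; nothing of
the owner's ∕ leaf-03's files modified or restated.  Net new unproved facts: 0.
-/

noncomputable section

namespace Literature.MathematicalPhysics.QuantumFieldTheory.Balaban1983to89.B9Eq315QTowerFlatNorm

open B4Sect5Torus (TSite)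
open B9SectCLatticeCarrier (Bond)
open B7Prop1Explicit (U1 Wcx boxVec)
open B9Eq319QprimeTorus (fineP)
open B9Eq315QTorus (perCfg cornerSite QtorusW)
open B9Eq315QTower (towerP UlevOf)
open B9Eq326OperatorTower (QkW)
open B11Eq103H1Complex (BondL2K)
open B9Eq316TowerFlatIsOneStep (towerP_eq_fineP_pow bondL2Cast norm_bondL2Cast QkW_one_eq_oneStep)
open B9Eq315QFlatNorm (norm_QtorusW_one_le)

variable {d : ℕ} {𝔸 : Type*} [NormedRing 𝔸] [NormedAlgebra ℂ 𝔸] [CompleteSpace 𝔸] [NormOneClass 𝔸]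
  (L : ℕ) [NeZero L] (m : Fin d → ℕ) [∀ i, NeZero (m i)] (n : ℕ)

/-! ## §1 The one-step flat data at block size `L^{n+1}` -/

omit [NormedAlgebra ℂ 𝔸] [CompleteSpace 𝔸] in
/-- The one-step flat background at block size `L^{n+1}` inhabits E162's displayed data: unit-bounded (`1 ∈ U1`) and with block loops EXACTLY `1`
(`B8Ineq130.Wcx_one`), so the regularity letter may be taken `0`. [cite: Balaban1985Averaging, (42)–(43) pp.23–24; Balaban1985BackgroundPropagators, (3.15) p.393] -/
theorem flat_oneStep_data_pow :
    (∀ (x : B7Prop1Explicit.Site d) (κ : Fin d),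
        perCfg (fineP (L ^ (n + 1)) m) (fun _ : Bond d (fineP (L ^ (n + 1)) m) => (1 : 𝔸ˣ)) x κ ∈ U1 𝔸) ∧
      ∀ (y : TSite d m) (κ : Fin d) (r : Fin d → Fin (L ^ (n + 1))),
        ‖((Wcx (L ^ (n + 1)) (perCfg (fineP (L ^ (n + 1)) m) (fun _ : Bond d (fineP (L ^ (n + 1)) m) => (1 : 𝔸ˣ))) (cornerSite (L ^ (n + 1)) y) κ
            (boxVec (L ^ (n + 1)) r) : 𝔸ˣ) : 𝔸) - 1‖ ≤ (0 : ℝ) := by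
  refine ⟨fun x κ => Subgroup.one_mem _, fun y κ r => ?_⟩
  rw [show perCfg (fineP (L ^ (n + 1)) m) (fun _ : Bond d (fineP (L ^ (n + 1)) m) => (1 : 𝔸ˣ)) = 1 from rfl, B8Ineq130.Wcx_one, Units.val_one,
    sub_self, norm_zero]

/-! ## §2 `‖Q_{n+1}(1)‖ ≤ M_φ′M_φ·√(c₁∕(c₀L^{(n+1)d}))` — volume-free -/

variable (hL : 1 ≤ L) {W : Type*} [NormedAddCommGroup W] [InnerProductSpace ℂ W] (φ : W ≃ₗ[ℂ] 𝔸) {c₀ c₁ : ℝ} [Fact (0 < c₀)] [Fact (0 < c₁)]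
  {Mφ Mφ' : ℝ} (hMφ : 0 ≤ Mφ) (hφ : ∀ w, ‖φ w‖ ≤ Mφ * ‖w‖) (hMφ' : 0 ≤ Mφ') (hφ' : ∀ X, ‖φ.symm X‖ ≤ Mφ' * ‖X‖)
  (α : ℕ → ℝ) (hα1 : ∀ j, α j ≤ 1 / 64)
  (hU1 : ∀ (j : ℕ) (x : B7Prop1Explicit.Site d) (κ : Fin d),
    perCfg (towerP L m (j + 1)) (UlevOf L m (n + 1) (fun _ : Bond d (towerP L m (n + 1)) => (1 : 𝔸ˣ)) j) x κ ∈ U1 𝔸)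
  (hreg : ∀ (j : ℕ) (y : TSite d (towerP L m j)) (κ : Fin d) (r : Fin d → Fin L),
    ‖((Wcx L (perCfg (towerP L m (j + 1)) (UlevOf L m (n + 1) (fun _ : Bond d (towerP L m (n + 1)) => (1 : 𝔸ˣ)) j)) (cornerSite L y) κ
      (boxVec L r) : 𝔸ˣ) : 𝔸) - 1‖ ≤ α j)

include hL hMφ hφ hMφ' hφ' in
/-- **THE FLAT COMPOSITE AVERAGING OF THE NE9 TOWER IS BOUNDED WITH A VOLUME-FREE CONSTANT**: for every admissible set of displayed per-level letters,
`‖Q_{n+1}(1)f‖_{L²(c₁)} ≤ M_φ′·M_φ·√(c₁∕(c₀·L^{(n+1)d}))·‖f‖_{L²(c₀)}` — the owner's `QkW_one_eq_oneStep` (`Q_{n+1}(1) = Q^{(L^{n+1})}(1) ∘ Φ`, `Φ` an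
isometry) followed by ne9-leaf-03's one-step count `norm_QtorusW_one_le` AT BLOCK SIZE `L^{n+1}`.  No site or bond count of any torus enters.
[cite: Balaban1985BackgroundPropagators, (3.15)–(3.16) p.393; Balaban1984PropagatorsI, (1.18) p.20; Balaban1985Averaging, (125) p.36, p.39] -/
theorem norm_QkW_one_le (f : BondL2K ℂ d (towerP L m (n + 1)) c₀ W) :
    ‖QkW L m n φ (fun _ : Bond d (towerP L m (n + 1)) => (1 : 𝔸ˣ)) hL α hα1 hU1 hreg (c₀ := c₀) (c₁ := c₁) f‖ ≤
      Mφ' * Mφ * Real.sqrt (c₁ / (c₀ * ((L : ℝ) ^ (n + 1)) ^ d)) * ‖f‖ := by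
  have hLk : 1 ≤ L ^ (n + 1) := Nat.one_le_pow _ _ hL
  obtain ⟨hU1', hreg'⟩ := flat_oneStep_data_pow (𝔸 := 𝔸) L m n
  rw [QkW_one_eq_oneStep L m n hL φ α hα1 hU1 hreg hLk (by norm_num : (0 : ℝ) ≤ 1 / 64) hU1' hreg' (towerP_eq_fineP_pow L m (n + 1)),
    LinearMap.comp_apply, LinearEquiv.coe_toLinearMap]
  have h := norm_QtorusW_one_le (L ^ (n + 1)) m hLk (by norm_num : (0 : ℝ) ≤ 1 / 64) hU1' hreg' φ (c₀ := c₀) (c₁ := c₁) hMφ hφ hMφ' hφ'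
    (bondL2Cast ℂ (towerP_eq_fineP_pow L m (n + 1)) f)
  rw [norm_bondL2Cast, Nat.cast_pow] at h
  exact h

include hL hMφ hφ hMφ' hφ' in
/-- **… AS AN OPERATOR-NORM BOUND**: `‖Q_{n+1}(1)‖_{L²(c₀) → L²(c₁)} ≤ M_φ′·M_φ·√(c₁∕(c₀·L^{(n+1)d}))` (the shape of the tower files' abstract `M_{Q1}`).
[cite: Balaban1985BackgroundPropagators, (3.15)–(3.16) p.393; Balaban1985Averaging, (125) p.36] -/
theorem opNorm_QkW_one_le [FiniteDimensional ℂ W] :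
    ‖LinearMap.toContinuousLinearMap
        (QkW L m n φ (fun _ : Bond d (towerP L m (n + 1)) => (1 : 𝔸ˣ)) hL α hα1 hU1 hreg (c₀ := c₀) (c₁ := c₁))‖ ≤
      Mφ' * Mφ * Real.sqrt (c₁ / (c₀ * ((L : ℝ) ^ (n + 1)) ^ d)) :=
  ContinuousLinearMap.opNorm_le_bound _ (by positivity) fun f => norm_QkW_one_le L m n hL φ hMφ hφ hMφ' hφ' α hα1 hU1 hreg f

/-! ## §3 Along print's weights (3.16): `‖Q_{n+1}(1)‖ ≤ M_φ′M_φ·(ηL^{n+1})⁻¹` -/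

omit [NeZero L] in
/-- the weight ratio along (3.16): `c₁(ηL^{n+1})² = c₀L^{(n+1)d}`, `0 < c₁`, `0 < ηL^{n+1}` ⇒ `√(c₁∕(c₀L^{(n+1)d})) = (ηL^{n+1})⁻¹`.
[cite: Balaban1985BackgroundPropagators, (3.16) p.393] -/
theorem sqrt_ratio_canonical {c₀ c₁ η : ℝ} (hc₁ : 0 < c₁) (hηL0 : 0 < η * (L : ℝ) ^ (n + 1))
    (hs : c₁ * (η * (L : ℝ) ^ (n + 1)) ^ 2 = c₀ * ((L : ℝ) ^ (n + 1)) ^ d) :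
    Real.sqrt (c₁ / (c₀ * ((L : ℝ) ^ (n + 1)) ^ d)) = (η * (L : ℝ) ^ (n + 1))⁻¹ := by
  have hq : c₁ / (c₀ * ((L : ℝ) ^ (n + 1)) ^ d) = ((η * (L : ℝ) ^ (n + 1))⁻¹) ^ 2 := by
    rw [← hs, ← div_div, div_self hc₁.ne', one_div, inv_pow]
  rw [hq, Real.sqrt_sq (inv_nonneg.2 hηL0.le)]

include hL hMφ hφ hMφ' hφ' in
/-- **`‖Q_{n+1}(1)f‖ ≤ M_φ′·M_φ·(ηL^{n+1})⁻¹·‖f‖` ALONG PRINT's WEIGHTS** `c₁(ηL^{n+1})² = c₀L^{(n+1)d}` — `M_φ′M_φ` on print's unit lattice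
`ηL^{n+1} = 1`; free of the volume `m`, of the block size and of the number of levels otherwise. The `hQ₁`∕`M_Q` display of
`B9Thm311SmallFieldCoercivityTowerScaled` inhabited. [cite: Balaban1985BackgroundPropagators, (3.15)–(3.16) p.393; Balaban1985Averaging, (125) p.36, p.39] -/
theorem norm_QkW_one_le_canonical {η : ℝ} (hηL0 : 0 < η * (L : ℝ) ^ (n + 1))
    (hs : c₁ * (η * (L : ℝ) ^ (n + 1)) ^ 2 = c₀ * ((L : ℝ) ^ (n + 1)) ^ d) (f : BondL2K ℂ d (towerP L m (n + 1)) c₀ W) :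
    ‖QkW L m n φ (fun _ : Bond d (towerP L m (n + 1)) => (1 : 𝔸ˣ)) hL α hα1 hU1 hreg (c₀ := c₀) (c₁ := c₁) f‖ ≤
      Mφ' * Mφ * (η * (L : ℝ) ^ (n + 1))⁻¹ * ‖f‖ := by
  have hc₁ : 0 < c₁ := Fact.out
  rw [← sqrt_ratio_canonical L n hc₁ hηL0 hs]
  exact norm_QkW_one_le L m n hL φ hMφ hφ hMφ' hφ' α hα1 hU1 hreg f

end Literature.MathematicalPhysics.QuantumFieldTheory.Balaban1983to89.B9Eq315QTowerFlatNorm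

end
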